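import Literature.Probability.Independence.BerryEsseenMajorant
import HarnessLib

/-!
# From a cubic complex-tilt expansion of the characteristic function to the Berry–Esseen majorant (model-free glue)

Topic `Literature/Probability/Independence` (continues `BerryEsseenMajorant.lean`: a majorant `|θ|e^{−θ²/4}(A + Bθ²)` of `‖φ_μ(θ) − e^{−θ²/2}‖` on a
window `|θ| < L` bounds the Kolmogorov distance to `𝒩(0,1)` by `(2A + 4B)/√π + 48/(5πL)`; rate form `O(1/r_n)`).
For statistics of transfer-matrix / rational-generating-function type the characteristic function at frequency `θ` is a ratio of partition functions at
the COMPLEX tilt `u = iθ/(σ√N)`, and complex two-term asymptotics give it in the form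
`φ(θ) = exp(−θ²/2 + E) · q`, with a CUBIC remainder `‖E‖ ≤ K(|θ| + |θ|³)/r` (from `N·O(|u|³)` and the amplitude's `O(|u|)`) and a factor `q`
with `‖q − 1‖ ≤ K′|θ|/r` (the geometric remainders of the two partition functions, Lipschitz in the tilt).  THIS FILE turns that shape into the
majorant, and hence into a Berry–Esseen RATE, with explicit constants:

* §1 the exponential remainder `‖e^z − 1‖ ≤ ‖z‖e^{‖z‖}` is Mathlib's `Complex.norm_exp_sub_sum_le_norm_mul_exp` at order one, used
  inline in §2 (it is also the tree lemma `Literature.NumberTheory.LFunctions.norm_cexp_sub_one_le_mul_exp`; not restated here).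
* §2 ★★ `norm_sub_gauss_le_of_cubic` — `φ = exp(−θ²/2 + E)`, `‖E‖ ≤ K(|θ| + |θ|³)/r`, `4K|θ| ≤ r` ⇒ `‖φ − e^{−θ²/2}‖ ≤ |θ|e^{−θ²/4}(3K + 3Kθ²)/r`;
  ★★ `norm_sub_gauss_le_of_cubic_mul` — the same with the factor `q` (`‖q‖ ≤ 2`, `‖q − 1‖ ≤ K′|θ|/r`): `≤ |θ|e^{−θ²/4}((6K + K′) + 6Kθ²)/r`.
* §3 ★★★ `abs_cdf_sub_gaussian_le_rate_of_cubic` — along a family of probability measures `μ_n` whose characteristic functions have that shape on the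
  window `|θ| < δ r_n` with `4Kδ ≤ 1`: `sup_x |μ_n(−∞,x] − 𝒩(−∞,x]| ≤ ((36K + 2K′)/√π + 48/(5πδ))/r_n` for every `n` (CAR «BERRY–ESSEEN MAJORANT»'s
  `abs_cdf_sub_gaussian_le_rate`).  What remains model-specific is ONE statement: the complex two-term asymptotics of the tilted partition function.

## Sources
R. Durrett, *Probability: Theory and Examples* (2019) §3.4.4 (proof of Theorem 3.4.17: the steps `|e^{−x} − (1 − x)|`, `n|α − β|`, here replaced by a
generic cubic remainder); W. Feller II (1971) XVI.5.  The formulation and constants are this lineage's (lane «pcv-sawmu», a-p5 g27); nothing is quoted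
AS PRINTED.
-/

noncomputable section

open MeasureTheory ProbabilityTheory Filter Complex Set
open scoped Topology Real

namespace Literature.Probability.Independence

/-! ## §2 ★★ The majorant from a cubic remainder -/

/-- ★★ **THE GAUSSIAN-WEIGHTED MAJORANT FROM A CUBIC REMAINDER.**  If `φ = exp(−θ²/2 + E)` with `‖E‖ ≤ K(|θ| + |θ|³)/r` (`K ≥ 0`, `r > 0`) and
`4K|θ| ≤ r`, then `‖φ − e^{−θ²/2}‖ ≤ |θ|·e^{−θ²/4}·(3K + 3K θ²)/r`.  (On the window, `‖E‖ ≤ ¼ + θ²/4`, so `‖e^E − 1‖ ≤ ‖E‖e^{¼}e^{θ²/4}` and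
`e^{¼} ≤ 3/2`.) [cite: Durrett2019, proof of Theorem 3.4.17 (lane statement with a generic cubic remainder)] -/
theorem norm_sub_gauss_le_of_cubic {θ K r : ℝ} {E : ℂ} (hK : 0 ≤ K) (hr : 0 < r) (hθ : 4 * K * |θ| ≤ r)
    (hE : ‖E‖ ≤ K * (|θ| + |θ| ^ 3) / r) :
    ‖cexp (-((θ : ℂ) ^ 2 / 2) + E) - cexp (-((θ : ℂ) ^ 2 / 2))‖ ≤ |θ| * Real.exp (-θ ^ 2 / 4) * ((3 * K + 3 * K * θ ^ 2) / r) := by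
  have hθ0 : 0 ≤ |θ| := abs_nonneg θ
  -- `‖E‖ ≤ 1/4 + θ²/4`
  have hKθ : K * |θ| / r ≤ 1 / 4 := by
    rw [div_le_iff₀ hr]; linarith
  have hE' : ‖E‖ ≤ 1 / 4 + θ ^ 2 / 4 := by
    have e : K * (|θ| + |θ| ^ 3) / r = K * |θ| / r + (K * |θ| / r) * θ ^ 2 := by
      rw [show |θ| ^ 3 = |θ| * θ ^ 2 by rw [← sq_abs θ]; ring]; field_simp
    rw [e] at hE
    have h2 : (K * |θ| / r) * θ ^ 2 ≤ (1 / 4) * θ ^ 2 := mul_le_mul_of_nonneg_right hKθ (sq_nonneg θ)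
    linarith
  -- factor the Gaussian
  have hψ : cexp (-((θ : ℂ) ^ 2 / 2) + E) - cexp (-((θ : ℂ) ^ 2 / 2)) = cexp (-((θ : ℂ) ^ 2 / 2)) * (cexp E - 1) := by
    rw [Complex.exp_add]; ring
  have hψn : ‖cexp (-((θ : ℂ) ^ 2 / 2))‖ = Real.exp (-θ ^ 2 / 2) := by
    rw [show (-((θ : ℂ) ^ 2 / 2)) = ((-θ ^ 2 / 2 : ℝ) : ℂ) by push_cast; ring, Complex.norm_exp_ofReal]
  rw [hψ, norm_mul, hψn]
  have h1 : ‖cexp E - 1‖ ≤ ‖E‖ * Real.exp ‖E‖ := by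
    simpa using Complex.norm_exp_sub_sum_le_norm_mul_exp E 1
  have h2 : Real.exp ‖E‖ ≤ Real.exp (1 / 4) * Real.exp (θ ^ 2 / 4) := by
    rw [← Real.exp_add]; exact Real.exp_le_exp.2 (by linarith)
  have he14 : Real.exp (1 / 4) ≤ 3 / 2 := by
    have := Real.exp_bound_div_one_sub_of_interval' (x := 1 / 4) (by norm_num) (by norm_num)
    -- `exp x ≤ 1/(1 - x)` for `0 ≤ x < 1`: `exp(1/4) < 4/3 ≤ 3/2`
    linarith
  have hexp4 : Real.exp (-θ ^ 2 / 2) * Real.exp (θ ^ 2 / 4) = Real.exp (-θ ^ 2 / 4) := by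
    rw [← Real.exp_add]; congr 1; ring
  have hEn : 0 ≤ ‖E‖ := norm_nonneg _
  calc Real.exp (-θ ^ 2 / 2) * ‖cexp E - 1‖
      ≤ Real.exp (-θ ^ 2 / 2) * (‖E‖ * (Real.exp (1 / 4) * Real.exp (θ ^ 2 / 4))) := by
        refine mul_le_mul_of_nonneg_left (h1.trans ?_) (Real.exp_pos _).le
        exact mul_le_mul_of_nonneg_left h2 hEn
    _ = Real.exp (-θ ^ 2 / 4) * Real.exp (1 / 4) * ‖E‖ := by rw [← hexp4]; ring
    _ ≤ Real.exp (-θ ^ 2 / 4) * (3 / 2) * (K * (|θ| + |θ| ^ 3) / r) := by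
        have h0 : 0 ≤ Real.exp (-θ ^ 2 / 4) := (Real.exp_pos _).le
        exact mul_le_mul (mul_le_mul_of_nonneg_left he14 h0) hE hEn (by positivity)
    _ = |θ| * Real.exp (-θ ^ 2 / 4) * ((3 / 2 * K + 3 / 2 * K * θ ^ 2) / r) := by
        rw [show |θ| ^ 3 = |θ| * θ ^ 2 by rw [← sq_abs θ]; ring]
        field_simp
    _ ≤ |θ| * Real.exp (-θ ^ 2 / 4) * ((3 * K + 3 * K * θ ^ 2) / r) := by
        have h0 : 0 ≤ |θ| * Real.exp (-θ ^ 2 / 4) := by positivity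
        refine mul_le_mul_of_nonneg_left (div_le_div_of_nonneg_right ?_ hr.le) h0
        nlinarith [sq_nonneg θ, hK]

/-- ★★ **THE MAJORANT WITH A GEOMETRIC FACTOR.**  If `φ = exp(−θ²/2 + E)·q` with `‖E‖ ≤ K(|θ| + |θ|³)/r`, `4K|θ| ≤ r`, `‖q‖ ≤ 2` and
`‖q − 1‖ ≤ K′|θ|/r` (`K ≥ 0`, `r > 0`), then `‖φ − e^{−θ²/2}‖ ≤ |θ|·e^{−θ²/4}·((6K + K′) + 6Kθ²)/r`.
[cite: Durrett2019, proof of Theorem 3.4.17 (lane statement with a generic cubic remainder and amplitude factor)] -/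
theorem norm_sub_gauss_le_of_cubic_mul {θ K K' r : ℝ} {E q : ℂ} (hK : 0 ≤ K) (hr : 0 < r) (hθ : 4 * K * |θ| ≤ r)
    (hE : ‖E‖ ≤ K * (|θ| + |θ| ^ 3) / r) (hq : ‖q‖ ≤ 2) (hq1 : ‖q - 1‖ ≤ K' * |θ| / r) :
    ‖cexp (-((θ : ℂ) ^ 2 / 2) + E) * q - cexp (-((θ : ℂ) ^ 2 / 2))‖
      ≤ |θ| * Real.exp (-θ ^ 2 / 4) * (((6 * K + K') + 6 * K * θ ^ 2) / r) := by
  have hmain := norm_sub_gauss_le_of_cubic hK hr hθ hE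
  have hψn : ‖cexp (-((θ : ℂ) ^ 2 / 2))‖ = Real.exp (-θ ^ 2 / 2) := by
    rw [show (-((θ : ℂ) ^ 2 / 2)) = ((-θ ^ 2 / 2 : ℝ) : ℂ) by push_cast; ring, Complex.norm_exp_ofReal]
  have hsplit : cexp (-((θ : ℂ) ^ 2 / 2) + E) * q - cexp (-((θ : ℂ) ^ 2 / 2))
      = (cexp (-((θ : ℂ) ^ 2 / 2) + E) - cexp (-((θ : ℂ) ^ 2 / 2))) * q + cexp (-((θ : ℂ) ^ 2 / 2)) * (q - 1) := by ring
  rw [hsplit]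
  have hg : Real.exp (-θ ^ 2 / 2) ≤ Real.exp (-θ ^ 2 / 4) := Real.exp_le_exp.2 (by nlinarith [sq_nonneg θ])
  calc ‖(cexp (-((θ : ℂ) ^ 2 / 2) + E) - cexp (-((θ : ℂ) ^ 2 / 2))) * q + cexp (-((θ : ℂ) ^ 2 / 2)) * (q - 1)‖
      ≤ ‖cexp (-((θ : ℂ) ^ 2 / 2) + E) - cexp (-((θ : ℂ) ^ 2 / 2))‖ * ‖q‖ + ‖cexp (-((θ : ℂ) ^ 2 / 2))‖ * ‖q - 1‖ := by
        refine (norm_add_le _ _).trans ?_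
        rw [norm_mul, norm_mul]
    _ ≤ |θ| * Real.exp (-θ ^ 2 / 4) * ((3 * K + 3 * K * θ ^ 2) / r) * 2 + Real.exp (-θ ^ 2 / 4) * (K' * |θ| / r) := by
        rw [hψn]
        have h0 : 0 ≤ |θ| * Real.exp (-θ ^ 2 / 4) * ((3 * K + 3 * K * θ ^ 2) / r) := by positivity
        exact add_le_add (mul_le_mul hmain hq (norm_nonneg _) h0)
          (mul_le_mul hg hq1 (norm_nonneg _) (Real.exp_pos _).le)
    _ = |θ| * Real.exp (-θ ^ 2 / 4) * (((6 * K + K') + 6 * K * θ ^ 2) / r) := by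
        field_simp
        ring

/-! ## §3 ★★★ The Berry–Esseen rate from the cubic complex-tilt expansion -/

/-- ★★★ **BERRY–ESSEEN RATE FROM A CUBIC COMPLEX-TILT EXPANSION (model-free).**  Let `μ_n` be probability measures on `ℝ`, `r_n > 0`, `δ > 0`,
`K, K′ ≥ 0` with `4Kδ ≤ 1`, and suppose that for every `n` and every `|θ| < δ r_n` the characteristic function has the form
`φ_{μ_n}(θ) = exp(−θ²/2 + E)·q` with `‖E‖ ≤ K(|θ| + |θ|³)/r_n`, `‖q‖ ≤ 2`, `‖q − 1‖ ≤ K′|θ|/r_n`.  Then for every `n` and `x`,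
`|μ_n(−∞,x] − 𝒩(0,1)(−∞,x]| ≤ ((36K + 2K′)/√π + 48/(5πδ))/r_n`.
(§2 gives the majorant with `a = 6K + K′`, `b = 6K`; `BerryEsseenMajorant.abs_cdf_sub_gaussian_le_rate` does the rest: `2a + 4b = 36K + 2K′`.)
[cite: Durrett2019, §3.4.4 Theorem 3.4.17 (lane statement: the rate from a generic cubic complex-tilt expansion); Feller1971, XVI.5] -/
theorem abs_cdf_sub_gaussian_le_rate_of_cubic {α : Type*} {μs : α → Measure ℝ} [∀ n, IsProbabilityMeasure (μs n)] {r : α → ℝ}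
    {δ K K' : ℝ} (hδ : 0 < δ) (hK : 0 ≤ K) (hK' : 0 ≤ K') (hKδ : 4 * K * δ ≤ 1) (hr : ∀ n, 0 < r n)
    (hφ : ∀ n, ∀ θ : ℝ, |θ| < δ * r n → ∃ E q : ℂ,
      charFun (μs n) θ = cexp (-((θ : ℂ) ^ 2 / 2) + E) * q ∧ ‖E‖ ≤ K * (|θ| + |θ| ^ 3) / r n ∧ ‖q‖ ≤ 2 ∧ ‖q - 1‖ ≤ K' * |θ| / r n)
    (n : α) (x : ℝ) :
    |(μs n).real (Iic x) - (gaussianReal 0 1).real (Iic x)|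
      ≤ ((2 * (6 * K + K') + 4 * (6 * K)) / √π + 48 / (5 * π * δ)) / r n := by
  refine abs_cdf_sub_gaussian_le_rate (μs := μs) (r := r) hδ (by positivity) (by positivity) hr (fun m θ hθ => ?_) n x
  obtain ⟨E, q, hφE, hE, hq, hq1⟩ := hφ m θ hθ
  have hrm := hr m
  have hθ4 : 4 * K * |θ| ≤ r m := by
    have h1 : |θ| ≤ δ * r m := hθ.le
    calc 4 * K * |θ| ≤ 4 * K * (δ * r m) := mul_le_mul_of_nonneg_left h1 (by positivity)
      _ = (4 * K * δ) * r m := by ring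
      _ ≤ 1 * r m := mul_le_mul_of_nonneg_right hKδ hrm.le
      _ = r m := one_mul _
  rw [hφE]
  have h := norm_sub_gauss_le_of_cubic_mul hK hrm hθ4 hE hq hq1
  rw [mul_div_assoc] 
  convert h using 2

end Literature.Probability.Independence

end
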